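/-
b2b-lace packet, TAIL-BOUND ANALYST gen 11 (unit `b2b-lace-tail-g11`).  (S2b)-IMPR TABLE-SIDE KIT, part (T1): the TRUE SRW
tables `τ₀` at which the Step leaves of [NoBLE17] §3.3.5 are stated, the discharge of the eight table-side hypotheses that
`NobleWeightedDiagramBoundTables` (lean2-g17) displays, the corollaries with ONLY the six cell inequalities left, and the
per-entry reduction of "a literal dominates a true `IM` entry" to the engines' three D80 inequalities.  Additive: no existing
module is modified; d-generic; no numeral; no named fact; no dimension sentence.
-/
import Literature.Probability.FitznerVanDerHofstad2017.NobleWeightedDiagramBoundTables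
import Literature.Probability.FitznerVanDerHofstad2017.F3BoundsTablesMonoAt
import HarnessLib

/-!
# Literature.Probability.FitznerVanDerHofstad2017.NobleF3TrueTables — the weighted-diagram bounds of `f₃` at the TRUE SRW tables

CITATION HEADER (PLACEMENT v2). Part of a certified REPRODUCTION of R. Fitzner, R. van der Hofstad, *Generalized approach to the
non-backtracking lace expansion*, Probab. Theory Related Fields 169 (2017) 1041–1119 [NoBLE17], §3.3.3 (3.29)–(3.30) and §3.3.4
(3.35)–(3.38) (the SRW tables `IM`, `T`, `U`, `K`) and §3.3.5 (3.58)–(3.87) (the bound on `f₃`), with the companion *Mean-field behavior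
for nearest-neighbor percolation in `d > 10`*, Electron. J. Probab. 22 (2017) no. 43 [FvdH17], (2.21)–(2.23) and §2.5:

> [NoBLE17] p. 1070, after (3.30): "… where `I_{n,l}`, `𝒥_{n,l}` … are SRW-integrals that we can compute numerically";
> p. 1076, (3.71): the bound on `∫ Ĥ₁ Ĝⁿ D̂^l D̂^{(x)}` "in terms of the SRW-integrals `I_{n,l}`, `𝒥_{n,l}`, `T_{n,l}`";
> p. 1079, (3.87): "`f₃(z) ≤ max_{{n,l,S} ∈ 𝒮} sup_{x ∈ S} (Σ_{i=1}^5 BoundH[i](n,l,x)) / c_{n,l,S}`".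

Every `[cite:]` tag below is a LOCATOR for comparison, not an appeal to authority: all statements are proved here from tree
theorems; the order lemmas are elementary (`[folklore]`).

## What this module does

`NobleWeightedDiagramBoundTables` (p-ids in HOME/LEMMAS) carries the (S2b)-IMPR assembly of [NoBLE17] §3.3.5 to the doorstep of the
numeric certificate with Step 1 discharged, displaying — besides the six cell inequalities — EIGHT table-side conditions on an abstract
table `τ : F3Bounds.Tables (Fin d → ℤ)`: `K = srwK`, `U = srwU`, (H-T) `srwTS ≤ τ.T`, (H-IM) `𝒥_{m+2,j} ≤ IM[m,j]`, (H-SC)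
`I_{m+3,j} ≤ d·α̲_F·IM[m,j]`, (H-LOW) `(ᾱ_F − 1)·S_{m+3,j} ≤ 2d²·IM[m,j]` (`m ≤ 1`), (H-IM1) `I_{1,j+1} + S_{2,j}/(2d²α̲_F) ≤ IM[−1,j]`,
(H-low1) `I_{2,j} ≤ d·α̲_F·IM[−1,j]` (`S_{p,l}` = `srwIShift2`, the shift sums of the D80-corrected Step 1, `SrwIntegralMassive`).

1. `F3Bounds.srwTrue d α̲ ᾱ` — the TRUE tables: `K := srwK d`, `U := srwU d`, `T := srwTS d α̲`, and
   `IM[m,l,v] := max (𝒥_{m+2,l}(v)) (max (I_{m+3,l}(v)/(dα̲)) ((ᾱ−1)·S_{m+3,l}(v)/(2d²)))` for `m ≥ 0`,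
   `IM[m,l,v] := max (I_{1,l+1}(v) + S_{2,l}(v)/(2d²α̲)) (I_{2,l}(v)/(dα̲))` for `m ≤ −1` — the pointwise-least table meeting the eight
   conditions (up to the `max`), so that the Step leaves hold AT `srwTrue` with no table hypothesis at all (§2).
2. The three corollaries of `NobleWeightedDiagramBoundTables` AT `τ := srwTrue` (§3): `nobleWeightedDiagramBoundAt_of_witness_srwTrue`,
   `nobleWeightedDiagramBoundAt_of_simplifiedFormF3_srwTrue`, `nobleImprovementInputsAt_of_simplifiedFormF3_srwTrue` — what remains displayed
   is `1 ≤ α̲_F`, well-formedness, (H-Γ) and the six CELL inequalities `boundHD75 (srwTrue d α̲ ᾱ) n_k l_k x r ≤ b_k` over `x ∈ calX d` / at `0`.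
3. The per-entry REDUCTION (§4): a real `t` dominates the true entry `IM[m,l,v]` (`m ≥ 0`) iff the engines' three D80 inequalities
   `𝒥_{m+2,l}(v) ≤ t`, `I_{m+3,l}(v) ≤ dα̲·t`, `(ᾱ−1)S_{m+3,l}(v) ≤ 2d²·t` hold (`srwTrue_IM_natCast_le_iff`), and the `m = −1` analogue —
   the exact finite obligations a certified table must meet, entry by entry, to dominate `srwTrue` at a node (the input of
   `F3Bounds.boundHD75_mono_at`, `F3BoundsTablesMonoAt`).

NOT here (other seats, HOME/LEMMAS (S2b)-IMPR TABLE-SIDE KIT row): the `d = 11` consumer and its literal tables, the cell-sup certificates.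

Heartbeat census (packet filing rule, REFEREE v73 ORDERS (2)): every declaration is a `rfl`, a `max` order step or a term-mode composition;
nothing approaches 100 000; no option set.
-/

noncomputable section

open MeasureTheory Real
open Literature.Barriers.CriticalPhenomena
open Literature.Barriers.CriticalPhenomena.Slade2006Prop53 (P)
open Literature.Probability.LatticeModels
open Literature.Probability.Percolation

namespace Literature.Probability.FitznerVanDerHofstad2017

variable {d : ℕ}

namespace F3Bounds

/-! ## 1. The true tables -/

/-- The true `IM` column of (S2b)-IMPR: for `m ≥ 0` the maximum of the three Step-1 slot quantities `𝒥_{m+2,l}(v)`, `I_{m+3,l}(v)/(dα̲)`,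
`(ᾱ−1)·S_{m+3,l}(v)/(2d²)`; for `m ≤ −1` the maximum of the two `m = −1` slot quantities `I_{1,l+1}(v) + S_{2,l}(v)/(2d²α̲)`, `I_{2,l}(v)/(dα̲)`.
[cite: FitznerVanDerHofstad2016NoBLE, §3.3.3 (3.29)–(3.30) p. 1070; §3.3.5 (3.61)–(3.63) pp. 1074–1076] -/
def srwTrueIM (d : ℕ) (afmin afmax : ℝ) : ℤ → ℕ → (Fin d → ℤ) → ℝ
  | Int.ofNat m, l, v => max (srwJ d (m + 2) l v)
      (max (srwI d (m + 3) l v / (d * afmin)) ((afmax - 1) * srwIShift2 d (m + 3) l v / (2 * (d : ℝ) ^ 2)))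
  | Int.negSucc _, l, v => max (srwI d 1 (l + 1) v + srwIShift2 d 2 l v / (2 * (d : ℝ) ^ 2 * afmin))
      (srwI d 2 l v / (d * afmin))

/-- **The TRUE SRW tables** `τ₀ = srwTrue d α̲ ᾱ`: `IM := srwTrueIM`, `T := srwTS d α̲` (`T_{m,l+1}`-type combination `K_{m,l+1} + (2/α̲)U_{m+1,l}`
of `NobleH2Step`), `U := srwU d` ((3.38)), `K := srwK d` ((3.36)).
[cite: FitznerVanDerHofstad2016NoBLE, §3.3.4 (3.35)–(3.38) p. 1071; §3.3.3 (3.29)–(3.30) p. 1070] -/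
def srwTrue (d : ℕ) (afmin afmax : ℝ) : Tables (Fin d → ℤ) where
  IM := srwTrueIM d afmin afmax
  T := fun m l v => srwTS d afmin m l v
  U := fun m l v => srwU d m l v
  K := fun m l v => srwK d m l v

variable {afmin afmax : ℝ}

/-- The `IM` column at `m ≥ 0`. [folklore] -/
@[simp] theorem srwTrue_IM_natCast (m l : ℕ) (v : Fin d → ℤ) :
    (srwTrue d afmin afmax).IM (m : ℤ) l v = max (srwJ d (m + 2) l v)
      (max (srwI d (m + 3) l v / (d * afmin)) ((afmax - 1) * srwIShift2 d (m + 3) l v / (2 * (d : ℝ) ^ 2))) := rfl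

/-- The `IM` column at `m = −1`. [folklore] -/
@[simp] theorem srwTrue_IM_negOne (l : ℕ) (v : Fin d → ℤ) :
    (srwTrue d afmin afmax).IM (-1) l v = max (srwI d 1 (l + 1) v + srwIShift2 d 2 l v / (2 * (d : ℝ) ^ 2 * afmin))
      (srwI d 2 l v / (d * afmin)) := rfl

/-- Every `m ≤ −1` row of the `IM` column equals the `m = −1` row (only `m = −1` is ever read). [folklore] -/
theorem srwTrue_IM_negSucc (k l : ℕ) (v : Fin d → ℤ) :
    (srwTrue d afmin afmax).IM (Int.negSucc k) l v = (srwTrue d afmin afmax).IM (-1) l v := rfl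

/-- The `T` column. [folklore] -/
@[simp] theorem srwTrue_T (m l : ℕ) (v : Fin d → ℤ) : (srwTrue d afmin afmax).T m l v = srwTS d afmin m l v := rfl

/-- The `U` column. [folklore] -/
@[simp] theorem srwTrue_U (m l : ℕ) (v : Fin d → ℤ) : (srwTrue d afmin afmax).U m l v = srwU d m l v := rfl

/-- The `K` column. [folklore] -/
@[simp] theorem srwTrue_K (m l : ℕ) (v : Fin d → ℤ) : (srwTrue d afmin afmax).K m l v = srwK d m l v := rfl

/-! ## 2. The eight table-side hypotheses hold at the true tables -/

/-- (H-IM) at the true tables. [folklore] -/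
theorem srwJ_le_srwTrue_IM (m l : ℕ) (v : Fin d → ℤ) : srwJ d (m + 2) l v ≤ (srwTrue d afmin afmax).IM m l v := by
  rw [srwTrue_IM_natCast]; exact le_max_left _ _

/-- (H-SC) at the true tables (`d ≥ 1`, `α̲ > 0`). [folklore] -/
theorem srwI_le_mul_srwTrue_IM (hd : 1 ≤ d) (hα : 0 < afmin) (m l : ℕ) (v : Fin d → ℤ) :
    srwI d (m + 3) l v ≤ d * afmin * (srwTrue d afmin afmax).IM m l v := by
  have hdpos : (0 : ℝ) < d := Nat.cast_pos.mpr (by omega)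
  have hpos : (0 : ℝ) < d * afmin := mul_pos hdpos hα
  have h : srwI d (m + 3) l v / (d * afmin) ≤ (srwTrue d afmin afmax).IM m l v := by
    rw [srwTrue_IM_natCast]; exact le_trans (le_max_left _ _) (le_max_right _ _)
  rw [mul_comm ((d : ℝ) * afmin)]
  exact (div_le_iff₀ hpos).1 h

/-- (H-LOW) at the true tables (`d ≥ 1`). [folklore] -/
theorem mul_srwIShift2_le_mul_srwTrue_IM (hd : 1 ≤ d) (m l : ℕ) (v : Fin d → ℤ) :
    (afmax - 1) * srwIShift2 d (m + 3) l v ≤ 2 * (d : ℝ) ^ 2 * (srwTrue d afmin afmax).IM m l v := by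
  have hdpos : (0 : ℝ) < d := Nat.cast_pos.mpr (by omega)
  have hpos : (0 : ℝ) < 2 * (d : ℝ) ^ 2 := mul_pos two_pos (pow_pos hdpos 2)
  have h : (afmax - 1) * srwIShift2 d (m + 3) l v / (2 * (d : ℝ) ^ 2) ≤ (srwTrue d afmin afmax).IM m l v := by
    rw [srwTrue_IM_natCast]; exact le_trans (le_max_right _ _) (le_max_right _ _)
  rw [mul_comm (2 * (d : ℝ) ^ 2)]
  exact (div_le_iff₀ hpos).1 h

/-- (H-IM1) at the true tables. [folklore] -/
theorem srwI_add_le_srwTrue_IM_negOne (l : ℕ) (v : Fin d → ℤ) :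
    srwI d 1 (l + 1) v + srwIShift2 d 2 l v / (2 * (d : ℝ) ^ 2 * afmin) ≤ (srwTrue d afmin afmax).IM (-1) l v := by
  rw [srwTrue_IM_negOne]; exact le_max_left _ _

/-- (H-low1) at the true tables (`d ≥ 1`, `α̲ > 0`). [folklore] -/
theorem srwI_two_le_mul_srwTrue_IM_negOne (hd : 1 ≤ d) (hα : 0 < afmin) (l : ℕ) (v : Fin d → ℤ) :
    srwI d 2 l v ≤ d * afmin * (srwTrue d afmin afmax).IM (-1) l v := by
  have hdpos : (0 : ℝ) < d := Nat.cast_pos.mpr (by omega)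
  have hpos : (0 : ℝ) < d * afmin := mul_pos hdpos hα
  have h : srwI d 2 l v / (d * afmin) ≤ (srwTrue d afmin afmax).IM (-1) l v := by
    rw [srwTrue_IM_negOne]; exact le_max_right _ _
  rw [mul_comm ((d : ℝ) * afmin)]
  exact (div_le_iff₀ hpos).1 h

/-- (H-T) at the true tables (with equality). [folklore] -/
theorem srwTS_le_srwTrue_T (m l : ℕ) (v : Fin d → ℤ) : srwTS d afmin m l v ≤ (srwTrue d afmin afmax).T m l v := le_rfl

/-! ## 4. Per-entry reduction: when does a literal dominate a true `IM` entry? -/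

/-- A real `t` dominates the true entry `IM[m,l,v]` (`m ≥ 0`) as soon as the three D80 inequalities hold:
`𝒥_{m+2,l}(v) ≤ t`, `I_{m+3,l}(v) ≤ dα̲·t`, `(ᾱ−1)·S_{m+3,l}(v) ≤ 2d²·t` (`d ≥ 1`, `α̲ > 0`). [folklore] -/
theorem srwTrue_IM_natCast_le (hd : 1 ≤ d) (hα : 0 < afmin) {m l : ℕ} {v : Fin d → ℤ} {t : ℝ}
    (hJ : srwJ d (m + 2) l v ≤ t) (hI : srwI d (m + 3) l v ≤ d * afmin * t)
    (hS : (afmax - 1) * srwIShift2 d (m + 3) l v ≤ 2 * (d : ℝ) ^ 2 * t) :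
    (srwTrue d afmin afmax).IM m l v ≤ t := by
  have hdpos : (0 : ℝ) < d := Nat.cast_pos.mpr (by omega)
  have hpos : (0 : ℝ) < d * afmin := mul_pos hdpos hα
  have hpos2 : (0 : ℝ) < 2 * (d : ℝ) ^ 2 := mul_pos two_pos (pow_pos hdpos 2)
  rw [srwTrue_IM_natCast]
  refine max_le hJ (max_le ?_ ?_)
  · rw [mul_comm ((d : ℝ) * afmin) t] at hI
    exact (div_le_iff₀ hpos).2 hI
  · rw [mul_comm (2 * (d : ℝ) ^ 2) t] at hS
    exact (div_le_iff₀ hpos2).2 hS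

/-- Conversely the three D80 inequalities are necessary (`d ≥ 1`, `α̲ > 0`): the characterisation. [folklore] -/
theorem srwTrue_IM_natCast_le_iff (hd : 1 ≤ d) (hα : 0 < afmin) {m l : ℕ} {v : Fin d → ℤ} {t : ℝ} :
    (srwTrue d afmin afmax).IM m l v ≤ t ↔
      srwJ d (m + 2) l v ≤ t ∧ srwI d (m + 3) l v ≤ d * afmin * t ∧
        (afmax - 1) * srwIShift2 d (m + 3) l v ≤ 2 * (d : ℝ) ^ 2 * t := by
  have hdpos : (0 : ℝ) < d := Nat.cast_pos.mpr (by omega)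
  have hpos : (0 : ℝ) < d * afmin := mul_pos hdpos hα
  have hpos2 : (0 : ℝ) < 2 * (d : ℝ) ^ 2 := mul_pos two_pos (pow_pos hdpos 2)
  refine ⟨fun h => ⟨?_, ?_, ?_⟩, fun h => srwTrue_IM_natCast_le hd hα h.1 h.2.1 h.2.2⟩
  · exact (srwJ_le_srwTrue_IM m l v).trans h
  · exact (srwI_le_mul_srwTrue_IM hd hα m l v).trans (by gcongr)
  · exact (mul_srwIShift2_le_mul_srwTrue_IM hd m l v).trans (by gcongr)

/-- A real `t` dominates the true entry `IM[−1,l,v]` as soon as `I_{1,l+1}(v) + S_{2,l}(v)/(2d²α̲) ≤ t` and `I_{2,l}(v) ≤ dα̲·t`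
(`d ≥ 1`, `α̲ > 0`). [folklore] -/
theorem srwTrue_IM_negOne_le (hd : 1 ≤ d) (hα : 0 < afmin) {l : ℕ} {v : Fin d → ℤ} {t : ℝ}
    (h1 : srwI d 1 (l + 1) v + srwIShift2 d 2 l v / (2 * (d : ℝ) ^ 2 * afmin) ≤ t) (h2 : srwI d 2 l v ≤ d * afmin * t) :
    (srwTrue d afmin afmax).IM (-1) l v ≤ t := by
  have hdpos : (0 : ℝ) < d := Nat.cast_pos.mpr (by omega)
  have hpos : (0 : ℝ) < d * afmin := mul_pos hdpos hα
  rw [srwTrue_IM_negOne]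
  refine max_le h1 ?_
  rw [mul_comm ((d : ℝ) * afmin) t] at h2
  exact (div_le_iff₀ hpos).2 h2

/-- The `m = −1` characterisation. [folklore] -/
theorem srwTrue_IM_negOne_le_iff (hd : 1 ≤ d) (hα : 0 < afmin) {l : ℕ} {v : Fin d → ℤ} {t : ℝ} :
    (srwTrue d afmin afmax).IM (-1) l v ≤ t ↔
      srwI d 1 (l + 1) v + srwIShift2 d 2 l v / (2 * (d : ℝ) ^ 2 * afmin) ≤ t ∧ srwI d 2 l v ≤ d * afmin * t := by
  refine ⟨fun h => ⟨?_, ?_⟩, fun h => srwTrue_IM_negOne_le hd hα h.1 h.2⟩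
  · exact (srwI_add_le_srwTrue_IM_negOne l v).trans h
  · have hdpos : (0 : ℝ) < d := Nat.cast_pos.mpr (by omega)
    exact (srwI_two_le_mul_srwTrue_IM_negOne hd hα l v).trans (by gcongr)

/-- Domination of the whole `IM` column at a node reduces to the rows `m ≥ 0` and the single row `m = −1`. [folklore] -/
theorem srwTrue_IM_le_of_natCast_of_negOne {τ' : Tables (Fin d → ℤ)} {v : Fin d → ℤ}
    (hnat : ∀ m l : ℕ, (srwTrue d afmin afmax).IM m l v ≤ τ'.IM m l v)
    (hneg : ∀ (k l : ℕ), (srwTrue d afmin afmax).IM (-1) l v ≤ τ'.IM (Int.negSucc k) l v) :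
    ∀ (m : ℤ) (l : ℕ), (srwTrue d afmin afmax).IM m l v ≤ τ'.IM m l v := by
  intro m l
  cases m with
  | ofNat m => exact hnat m l
  | negSucc k => exact (srwTrue_IM_negSucc k l v).le.trans (hneg k l)

end F3Bounds

open F3Bounds

/-! ## 3. The weighted-diagram bounds of `f₃` at the true tables: only the cells remain -/

/-- **(S2b)-IMPR at the TRUE tables, from an admissible witness.**  For `d ≥ 9`, `p < p_c`, an admissible witness of the extended simplified
form at well-formed `r` with (H-Γ) at `n = 0, 1` and `1 ≤ α̲_F`: the six cell inequalities `boundHD75 (srwTrue d α̲_F ᾱ_F) n_k l_k x r ≤ b_k`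
(`b_k ≥ 0`) give `NobleWeightedDiagramBoundAt d p b` — [NoBLE17] (3.87) at the six cells of [FvdH17] (2.23) with every table-side condition
discharged (`τ.K = K`, `τ.U = U`, `τ.T = TS`, (H-IM), (H-SC), (H-LOW), (H-IM1), (H-low1) hold at `srwTrue` by §2).
[cite: FitznerVanDerHofstad2016NoBLE, §3.3.5 (3.87) p. 1079 with (3.58)–(3.86) pp. 1074–1079] [cite: FitznerVanDerHofstad2017, (2.21)–(2.23), §2.5] -/
theorem nobleWeightedDiagramBoundAt_of_witness_srwTrue (hd : 9 ≤ d) {p : unitInterval}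
    (hp : (p : ℝ) < criticalProb (zdGraph d) (0 : Site d)) {B : NobleBeta} {E : NobleBetaF3} {r : F3Bounds.Args}
    (hW : ∃ (cΦ αΦ cF αF : ℝ) (RΦ RF : Site d → ℝ), NobleF3Witness d p B E r cΦ αΦ cF αF RΦ RF)
    (hr : r.WF) (hΓ : ∀ n ≤ 1, r.Gamma2dash ^ n * r.bRp ≤ r.bRpDelta) (hα1 : 1 ≤ r.afmin)
    {b : Fin 6 → ℝ} (hb : ∀ k, 0 ≤ b k)
    (h0 : ∀ x ∈ calX d, boundHD75 (srwTrue d r.afmin r.afmax) 0 0 x r ≤ b 0)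
    (h1 : ∀ x ∈ calX d, boundHD75 (srwTrue d r.afmin r.afmax) 1 0 x r ≤ b 1)
    (h2 : ∀ x ∈ calX d, boundHD75 (srwTrue d r.afmin r.afmax) 1 1 x r ≤ b 2)
    (h3 : ∀ x ∈ calX d, boundHD75 (srwTrue d r.afmin r.afmax) 1 2 x r ≤ b 3)
    (h4 : ∀ x ∈ calX d, boundHD75 (srwTrue d r.afmin r.afmax) 1 3 x r ≤ b 4)
    (h5 : boundHD75 (srwTrue d r.afmin r.afmax) 1 6 0 r ≤ b 5) :
    NobleWeightedDiagramBoundAt d p b :=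
  have hd1 : 1 ≤ d := by omega
  have hα : 0 < r.afmin := lt_of_lt_of_le one_pos hα1
  nobleWeightedDiagramBoundAt_of_witness_tables hd hp hW hr hΓ hα1 (srwTrue d r.afmin r.afmax)
    (fun _ _ _ => rfl) (fun _ _ _ => rfl) (fun m j y => srwTS_le_srwTrue_T m j y)
    (fun m j y _ => srwJ_le_srwTrue_IM m j y) (fun m j y _ => srwI_le_mul_srwTrue_IM hd1 hα m j y)
    (fun m j y _ => mul_srwIShift2_le_mul_srwTrue_IM hd1 m j y) (fun j y => srwI_add_le_srwTrue_IM_negOne j y)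
    (fun j y => srwI_two_le_mul_srwTrue_IM_negOne hd1 hα j y) hb h0 h1 h2 h3 h4 h5

/-- **(S2b)-IMPR at the TRUE tables, from the extended simplified form** `NobleSimplifiedFormF3At d p B E` below `p_c` under `f₂(p) ≤ Γ₂`, at
`r = NobleBetaF3.toArgs d B E Γ₂` (`1 ≤ α̲_F = B.αFlow`, `β_Δ < α̲_F`): only the six cells at `srwTrue d B.αFlow E.αFup` remain.
[cite: FitznerVanDerHofstad2016NoBLE, §3.3.5 (3.87) p. 1079; §3.3.4 pp. 1072–1074] [cite: FitznerVanDerHofstad2017, (2.21)–(2.23), §2.5] -/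
theorem nobleWeightedDiagramBoundAt_of_simplifiedFormF3_srwTrue (hd : 9 ≤ d) {p : unitInterval}
    (hp : (p : ℝ) < criticalProb (zdGraph d) (0 : Site d)) {B : NobleBeta} {E : NobleBetaF3} {Γ₂ : ℝ}
    (hF3 : NobleSimplifiedFormF3At d p B E) (hΓ2 : nobleF2 d p ≤ Γ₂) (hα1 : 1 ≤ B.αFlow) (hgap : B.βΔ < B.αFlow)
    (hr : (NobleBetaF3.toArgs d B E Γ₂).WF)
    (hΓ : ∀ n ≤ 1, (NobleBetaF3.toArgs d B E Γ₂).Gamma2dash ^ n * (NobleBetaF3.toArgs d B E Γ₂).bRp ≤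
      (NobleBetaF3.toArgs d B E Γ₂).bRpDelta)
    {b : Fin 6 → ℝ} (hb : ∀ k, 0 ≤ b k)
    (h0 : ∀ x ∈ calX d, boundHD75 (srwTrue d B.αFlow E.αFup) 0 0 x (NobleBetaF3.toArgs d B E Γ₂) ≤ b 0)
    (h1 : ∀ x ∈ calX d, boundHD75 (srwTrue d B.αFlow E.αFup) 1 0 x (NobleBetaF3.toArgs d B E Γ₂) ≤ b 1)
    (h2 : ∀ x ∈ calX d, boundHD75 (srwTrue d B.αFlow E.αFup) 1 1 x (NobleBetaF3.toArgs d B E Γ₂) ≤ b 2)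
    (h3 : ∀ x ∈ calX d, boundHD75 (srwTrue d B.αFlow E.αFup) 1 2 x (NobleBetaF3.toArgs d B E Γ₂) ≤ b 3)
    (h4 : ∀ x ∈ calX d, boundHD75 (srwTrue d B.αFlow E.αFup) 1 3 x (NobleBetaF3.toArgs d B E Γ₂) ≤ b 4)
    (h5 : boundHD75 (srwTrue d B.αFlow E.αFup) 1 6 0 (NobleBetaF3.toArgs d B E Γ₂) ≤ b 5) :
    NobleWeightedDiagramBoundAt d p b :=
  have hd1 : 1 ≤ d := by omega
  have hα : 0 < B.αFlow := lt_of_lt_of_le one_pos hα1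
  nobleWeightedDiagramBoundAt_of_simplifiedFormF3_tables hd hp hF3 hΓ2 hα1 hgap hr hΓ (srwTrue d B.αFlow E.αFup)
    (fun _ _ _ => rfl) (fun _ _ _ => rfl) (fun m j y => srwTS_le_srwTrue_T m j y)
    (fun m j y _ => srwJ_le_srwTrue_IM m j y) (fun m j y _ => srwI_le_mul_srwTrue_IM hd1 hα m j y)
    (fun m j y _ => mul_srwIShift2_le_mul_srwTrue_IM hd1 m j y) (fun j y => srwI_add_le_srwTrue_IM_negOne j y)
    (fun j y => srwI_two_le_mul_srwTrue_IM_negOne hd1 hα j y) hb h0 h1 h2 h3 h4 h5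

/-- **The improvement-step input of the numeric certificate at the TRUE tables** — no table-side condition of §3.3.5 left displayed.  For `d ≥ 9`:
if at every `p ∈ (p_I, p_c)` with `f_i(p) ≤ Γ_i` the two-point function has the extended simplified form `NobleSimplifiedFormF3At d p B E`,
`1 ≤ α̲_F`, `β_Δ < α̲_F`, `r = NobleBetaF3.toArgs d B E (Γ 1)` is well formed with (H-Γ) at `n = 0, 1`, and the six cell inequalities hold at
`srwTrue d B.αFlow E.αFup` with `b_k ≥ 0`, then `NobleImprovementInputsAt d cμ c Γ B b`.
[cite: FitznerVanDerHofstad2016NoBLE, §3.3.5 (3.87) p. 1079 with Steps 1–5; Assumption 2.7 and Prop. 4.5 (pp. 1059–1060, 1088)]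
[cite: FitznerVanDerHofstad2017, Prop. 2.1–2.2, (2.21)–(2.23), §2.5] -/
theorem nobleImprovementInputsAt_of_simplifiedFormF3_srwTrue (hd : 9 ≤ d) {cμ : ℝ} {c : Fin 6 → ℝ} {Γ : Fin 3 → ℝ}
    {B : NobleBeta} {E : NobleBetaF3}
    (hF3 : ∀ p : unitInterval, p ∈ Set.Ioo (nbwThresholdI d) (criticalProbI d) →
      (∀ i, nobleF d cμ c i p ≤ Γ i) → NobleSimplifiedFormF3At d p B E)
    (hα1 : 1 ≤ B.αFlow) (hgap : B.βΔ < B.αFlow) (hr : (NobleBetaF3.toArgs d B E (Γ 1)).WF)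
    (hΓ : ∀ n ≤ 1, (NobleBetaF3.toArgs d B E (Γ 1)).Gamma2dash ^ n * (NobleBetaF3.toArgs d B E (Γ 1)).bRp ≤
      (NobleBetaF3.toArgs d B E (Γ 1)).bRpDelta)
    {b : Fin 6 → ℝ} (hb : ∀ k, 0 ≤ b k)
    (h0 : ∀ x ∈ calX d, boundHD75 (srwTrue d B.αFlow E.αFup) 0 0 x (NobleBetaF3.toArgs d B E (Γ 1)) ≤ b 0)
    (h1 : ∀ x ∈ calX d, boundHD75 (srwTrue d B.αFlow E.αFup) 1 0 x (NobleBetaF3.toArgs d B E (Γ 1)) ≤ b 1)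
    (h2 : ∀ x ∈ calX d, boundHD75 (srwTrue d B.αFlow E.αFup) 1 1 x (NobleBetaF3.toArgs d B E (Γ 1)) ≤ b 2)
    (h3 : ∀ x ∈ calX d, boundHD75 (srwTrue d B.αFlow E.αFup) 1 2 x (NobleBetaF3.toArgs d B E (Γ 1)) ≤ b 3)
    (h4 : ∀ x ∈ calX d, boundHD75 (srwTrue d B.αFlow E.αFup) 1 3 x (NobleBetaF3.toArgs d B E (Γ 1)) ≤ b 4)
    (h5 : boundHD75 (srwTrue d B.αFlow E.αFup) 1 6 0 (NobleBetaF3.toArgs d B E (Γ 1)) ≤ b 5) :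
    NobleImprovementInputsAt d cμ c Γ B b :=
  have hd1 : 1 ≤ d := by omega
  have hα : 0 < B.αFlow := lt_of_lt_of_le one_pos hα1
  nobleImprovementInputsAt_of_simplifiedFormF3_tables hd hF3 hα1 hgap hr hΓ (srwTrue d B.αFlow E.αFup)
    (fun _ _ _ => rfl) (fun _ _ _ => rfl) (fun m j y => srwTS_le_srwTrue_T m j y)
    (fun m j y _ => srwJ_le_srwTrue_IM m j y) (fun m j y _ => srwI_le_mul_srwTrue_IM hd1 hα m j y)
    (fun m j y _ => mul_srwIShift2_le_mul_srwTrue_IM hd1 m j y) (fun j y => srwI_add_le_srwTrue_IM_negOne j y)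
    (fun j y => srwI_two_le_mul_srwTrue_IM_negOne hd1 hα j y) hb h0 h1 h2 h3 h4 h5

/-! ## 5. Transport of the cells to a dominating table at the node (the certificate-side entry point) -/

/-- **Cells at a dominating table.**  If a table `τ'` dominates the true tables AT THE NODE `v` — rows `m ≥ 0` of `IM` via the three D80
inequalities per entry (`srwTrue_IM_natCast_le`), rows `m ≤ −1` via the two `m = −1` inequalities, and `TS ≤ τ'.T`, `U ≤ τ'.U`, `K ≤ τ'.K`
entrywise at `v` — then on well-formed arguments `boundHD75 (srwTrue d α̲ ᾱ) n l v a ≤ boundHD75 τ' n l v a`; so a cell inequality proved for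
`τ'` transfers to the true tables (`F3Bounds.boundHD75_mono_at`). [folklore] -/
theorem boundHD75_srwTrue_le_of_dom_at {afmin afmax : ℝ} {τ' : Tables (Fin d → ℤ)} {v : Fin d → ℤ} {a : F3Bounds.Args} (ha : a.WF)
    (hnat : ∀ m l : ℕ, (srwTrue d afmin afmax).IM m l v ≤ τ'.IM m l v)
    (hneg : ∀ (k l : ℕ), (srwTrue d afmin afmax).IM (-1) l v ≤ τ'.IM (Int.negSucc k) l v)
    (hT : ∀ m l, srwTS d afmin m l v ≤ τ'.T m l v) (hU : ∀ m l, srwU d m l v ≤ τ'.U m l v)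
    (hK : ∀ m l, srwK d m l v ≤ τ'.K m l v) (n l : ℕ) :
    boundHD75 (srwTrue d afmin afmax) n l v a ≤ boundHD75 τ' n l v a :=
  boundHD75_mono_at ha (srwTrue_IM_le_of_natCast_of_negOne hnat hneg) hT hU hK n l

end Literature.Probability.FitznerVanDerHofstad2017

end
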